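import Mathlib
import Summits.Ventures.PercRepro2.SLevelCD
import Summits.Ventures.PercRepro2.CaseOnePendant

/-!
# (CD) holds when `a₃` is a leaf at `a₁` — the first kernel instance class of the
covariance-monotone statement (blind cell PercRepro2, mine-c g12; mine-a g11 MINEA-CD.md §5
Theorem A, paper; p1 g13 `CaseOnePendant.lean` = the (i)/(ii) rows of the same class)

Let `e₀` be the only edge at `a₃`, joining it to `a₁` (p1's `IsLeafAt`), `o, a₂ ≠ a₃`. Then for EVERY
increasing `F` of the revealed cluster, `covS F φ ≤ 0`, i.e. `SLevel.CD` holds (`cd_of_leaf`).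
Proof (mine-a's Theorem A in the `S`-level vocabulary): `covS F φ` in ω-form (`covS_phi_eq_omega`, the
tower identity `expect_clusterFun_inter_eq_expect`) splits over the state of `e₀` (`expect_eq_pin`,
`expect_update_one/zero`): with `q = P(Q)`, `Z = P(Q, o ∈ C₂)`, `M₁ = P(Q, o ∈ C₁)` (all ignore `e₀`),
`X = E_{p[e₀↦1]}[F(C₁) 1[o∈C₂] 1_Q]`, `Y = E_{p[e₀↦1]}[F(C₁) 1_Q] ≥ Y⁰ = E_{p[e₀↦0]}[F(C₁) 1_Q]`, one finds
`D = (1−p₀) q`, `D_o = (1−p₀)(M₁ + Z)` and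
  `covS F φ = p₀ (1−p₀) q · [ (q X − Z Y) − (1−p₀) M₁ (Y − Y⁰) ]`,
where `q X − Z Y ≤ 0` is BHK06 Thm 1.4 in functional form under `p[e₀↦1]` (`bhk_cross_cluster_fun`) and
the second term is `≤ 0` by monotonicity of `F` (`expect_update_zero_le_expect_update_one`-type coupling).
Nothing beyond the leaf class is claimed. -/

namespace Summit.Ventures.PercRepro2

open UnionCluster

namespace SLevel

section Omega

variable {V : Type*} {E : Type*} [Fintype E] [DecidableEq E] [Fintype V] [DecidableEq V]
  {R : Type*} [Field R] [LinearOrder R] [IsStrictOrderedRing R]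

variable (p : E → R) (ends : E → Sym2 V) (o a₁ a₂ a₃ : V)

local notation3 "Q" => avoidAll ends a₂ {a₁}
local notation3 "𝟙Q" => (avoidAll ends a₂ {a₁}).indicator (1 : Config E → R)
local notation3 "𝟙e" => (connEvent ends a₁ a₃).indicator (1 : Config E → R)
local notation3 "𝟙f" => (connEvent ends a₂ o).indicator (1 : Config E → R)
local notation3 "D" => prob p (PDEvent ends a₁ a₂ a₃)
local notation3 "Dₒ" => CovForm.Do p ends o a₁ a₂ a₃

omit [DecidableEq V] [LinearOrder R] [IsStrictOrderedRing R] in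
/-- The tower identity for a cluster functional times `1[a₃ ∈ C₁]`, `Q`-form. -/
lemma tower_F (F : Set V → R) :
    expect p (fun ω => F (cluster ends ω a₁) * 𝟙e ω * 𝟙f ω * 𝟙Q ω) =
      expect p (fun ω => F (cluster ends ω a₁) * 𝟙e ω * hS p ends a₂ o (cluster ends ω a₁) * 𝟙Q ω) := by
  have h := CaseOne.expect_clusterFun_inter_eq_expect p ends a₁ a₂
    (fun W => F W * indS a₃ W) {W : Set V | o ∈ W}
  rw [CovForm.compl_connEvent_eq_Q] at h
  have e1 : ∀ ω : Config E, (fun W => F W * indS a₃ W) (cluster ends ω a₁) *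
      ({W : Set V | o ∈ W}).indicator (1 : Set V → R) (cluster ends ω a₂) * 𝟙Q ω =
      F (cluster ends ω a₁) * 𝟙e ω * 𝟙f ω * 𝟙Q ω := by
    intro ω
    simp only [indS]
    rw [CaseOne.ind_cluster_eq ends a₁ a₃ ω, CaseOne.ind_cluster_eq ends a₂ o ω]
  have e2 : ∀ ω : Config E, (fun W => F W * indS a₃ W) (cluster ends ω a₁) *
      delClusterProb p ends a₂ {W : Set V | o ∈ W} (cluster ends ω a₁) * 𝟙Q ω =
      F (cluster ends ω a₁) * 𝟙e ω * hS p ends a₂ o (cluster ends ω a₁) * 𝟙Q ω := by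
    intro ω
    simp only [indS, hS]
    rw [CaseOne.ind_cluster_eq ends a₁ a₃ ω]
  simp only [e1, e2] at h
  exact h

omit [DecidableEq V] [LinearOrder R] [IsStrictOrderedRing R] in
/-- **`covS F φ` in ω-form**: the `S`-level covariance of `F` with `φ = D·e·(h_o − γ)` equals the cleared
covariance of `F(C₁)` with `D·1[a₃∈C₁]·1[o∈C₂] − D_o·1[a₃∈C₁]` under `Q`. -/
theorem covS_phi_eq_omega (F : Set V → R) :
    covS p ends a₁ a₂ F (phi p ends o a₁ a₂ a₃) =
      prob p Q * (D * expect p (fun ω => F (cluster ends ω a₁) * 𝟙e ω * 𝟙f ω * 𝟙Q ω) -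
          Dₒ * expect p (fun ω => F (cluster ends ω a₁) * 𝟙e ω * 𝟙Q ω)) -
        expect p (fun ω => F (cluster ends ω a₁) * 𝟙Q ω) *
          (D * expect p (fun ω => 𝟙e ω * 𝟙f ω * 𝟙Q ω) - Dₒ * expect p (fun ω => 𝟙e ω * 𝟙Q ω)) := by
  have t1 := tower_F p ends o a₁ a₂ a₃ F
  have t2 := tower_F p ends o a₁ a₂ a₃ (fun _ => (1 : R))
  simp only [one_mul] at t2
  rw [t1, t2]
  unfold covS phi
  have x1 : expect p (fun ω => F (cluster ends ω a₁) *
      (indS a₃ (cluster ends ω a₁) * (D * hS p ends a₂ o (cluster ends ω a₁) - Dₒ)) * 𝟙Q ω) =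
      D * expect p (fun ω => F (cluster ends ω a₁) * 𝟙e ω * hS p ends a₂ o (cluster ends ω a₁) * 𝟙Q ω) -
        Dₒ * expect p (fun ω => F (cluster ends ω a₁) * 𝟙e ω * 𝟙Q ω) := by
    rw [← expect_const_mul, ← expect_const_mul, ← expect_sub]
    congr 1; funext ω
    simp only [Pi.sub_apply, indS]
    rw [CaseOne.ind_cluster_eq ends a₁ a₃ ω]
    ring
  have x2 : expect p (fun ω => indS a₃ (cluster ends ω a₁) *
      (D * hS p ends a₂ o (cluster ends ω a₁) - Dₒ) * 𝟙Q ω) =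
      D * expect p (fun ω => 𝟙e ω * hS p ends a₂ o (cluster ends ω a₁) * 𝟙Q ω) -
        Dₒ * expect p (fun ω => 𝟙e ω * 𝟙Q ω) := by
    rw [← expect_const_mul, ← expect_const_mul, ← expect_sub]
    congr 1; funext ω
    simp only [Pi.sub_apply, indS]
    rw [CaseOne.ind_cluster_eq ends a₁ a₃ ω]
    ring
  rw [x1, x2]

end Omega

section Leaf

variable {V : Type*} {E : Type*} [Fintype E] [DecidableEq E] [Fintype V] [DecidableEq V]
  {R : Type*} [Field R] [LinearOrder R] [IsStrictOrderedRing R]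

variable (p : E → R) (ends : E → Sym2 V) (o a₁ a₂ a₃ : V) (e₀ : E)

local notation3 "Q" => avoidAll ends a₂ {a₁}
local notation3 "𝟙Q" => (avoidAll ends a₂ {a₁}).indicator (1 : Config E → R)
local notation3 "𝟙e" => (connEvent ends a₁ a₃).indicator (1 : Config E → R)
local notation3 "𝟙f" => (connEvent ends a₂ o).indicator (1 : Config E → R)
local notation3 "𝟙o₁" => (connEvent ends a₁ o).indicator (1 : Config E → R)
local notation3 "D" => prob p (PDEvent ends a₁ a₂ a₃)
local notation3 "Dₒ" => CovForm.Do p ends o a₁ a₂ a₃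
local notation3 "upd₁" => fun ω : Config E => Function.update ω e₀ true
local notation3 "upd₀" => fun ω : Config E => Function.update ω e₀ false

omit [Fintype E] [Fintype V] [DecidableEq V] [LinearOrder R] [IsStrictOrderedRing R] in
/-- `Q` ignores the leaf edge. -/
lemma mem_Q_update_iff (hl : CaseOne.IsLeafAt ends a₁ a₃ e₀) (h2 : a₂ ≠ a₃) (ω : Config E)
    (c : Bool) : Function.update ω e₀ c ∈ Q ↔ ω ∈ Q := by
  simp only [mem_avoidAll, Finset.mem_singleton, forall_eq]
  rw [CaseOne.conn_iff_update_of_leaf hl ω h2 hl.ne,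
    CaseOne.conn_iff_update_of_leaf hl (Function.update ω e₀ c) h2 hl.ne, Function.update_idem]

omit [Fintype E] [Fintype V] [DecidableEq V] [LinearOrder R] [IsStrictOrderedRing R] in
/-- The indicator of `Q` ignores the leaf edge. -/
lemma Q_indicator_update (hl : CaseOne.IsLeafAt ends a₁ a₃ e₀) (h2 : a₂ ≠ a₃) (ω : Config E)
    (c : Bool) : 𝟙Q (Function.update ω e₀ c) = 𝟙Q ω := by
  by_cases h : ω ∈ Q
  · rw [Set.indicator_of_mem h, Set.indicator_of_mem ((mem_Q_update_iff ends a₁ a₂ a₃ e₀ hl h2 ω c).2 h)]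
    rfl
  · rw [Set.indicator_of_notMem h,
      Set.indicator_of_notMem (fun h' => h ((mem_Q_update_iff ends a₁ a₂ a₃ e₀ hl h2 ω c).1 h'))]

omit [Fintype V] [DecidableEq V] [LinearOrder R] [IsStrictOrderedRing R] in
/-- `E[g · 1[e open]] = p(e) · E[g ∘ upd₁]` (no hypothesis on `g`). -/
lemma expect_mul_openEdge (g : Config E → R) :
    expect p (fun ω => g ω * (openEdge e₀).indicator 1 ω) =
      p e₀ * expect p (fun ω => g (Function.update ω e₀ true)) := by
  rw [expect_eq_pin p _ e₀, expect_update_one, expect_update_zero]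
  have h1 : expect p (fun ω => g (Function.update ω e₀ true) *
      (openEdge e₀).indicator (1 : Config E → R) (Function.update ω e₀ true)) =
      expect p (fun ω => g (Function.update ω e₀ true)) := by
    congr 1; funext ω
    rw [Set.indicator_of_mem (show Function.update ω e₀ true ∈ openEdge e₀ by simp [openEdge])]
    simp
  have h0 : expect p (fun ω => g (Function.update ω e₀ false) *
      (openEdge e₀).indicator (1 : Config E → R) (Function.update ω e₀ false)) = 0 := by
    rw [show (fun ω => g (Function.update ω e₀ false) *
        (openEdge e₀).indicator (1 : Config E → R) (Function.update ω e₀ false)) = fun _ => 0 from by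
      funext ω
      rw [Set.indicator_of_notMem (show Function.update ω e₀ false ∉ openEdge e₀ by simp [openEdge])]
      simp]
    simp [expect]
  rw [h1, h0]
  ring

omit [Fintype V] [DecidableEq V] [LinearOrder R] [IsStrictOrderedRing R] in
/-- `E[g] = p(e) · E[g ∘ upd₁] + (1 − p(e)) · E[g ∘ upd₀]`. -/
lemma expect_split (g : Config E → R) :
    expect p g = p e₀ * expect p (fun ω => g (Function.update ω e₀ true)) +
      (1 - p e₀) * expect p (fun ω => g (Function.update ω e₀ false)) := by
  rw [expect_eq_pin p g e₀, expect_update_one, expect_update_zero]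

omit [Fintype E] [DecidableEq E] [Fintype V] [DecidableEq V] [LinearOrder R] [IsStrictOrderedRing R] in
/-- Under the leaf hypothesis `PD = Q ∩ {e₀ closed}`. -/
lemma PDEvent_eq_of_leaf (hl : CaseOne.IsLeafAt ends a₁ a₃ e₀) (h2 : a₂ ≠ a₃) :
    PDEvent ends a₁ a₂ a₃ = Q ∩ closedEdge e₀ := by
  ext ω
  simp only [PDEvent, Dtilde, Set.mem_inter_iff, Set.mem_compl_iff, mem_connEvent, mem_inU,
    mem_avoidAll, Finset.mem_singleton, forall_eq, closedEdge, Set.mem_setOf_eq]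
  constructor
  · rintro ⟨hQ, hU⟩
    refine ⟨fun h => hQ (conn_symm h), ?_⟩
    by_contra hc
    simp only [Bool.not_eq_false] at hc
    exact hU (Or.inl (conn_symm ((CaseOne.conn_leaf_iff hl ω).2 hc)))
  · rintro ⟨hQ, hc⟩
    refine ⟨fun h => hQ (conn_symm h), ?_⟩
    rintro (h | h)
    · exact absurd ((CaseOne.conn_leaf_iff hl ω).1 (conn_symm h)) (by simp [hc])
    · exact h2 (CaseOne.eq_of_conn_leaf_of_closed hl hc h)

omit [DecidableEq V] in
/-- **(CD) holds when `a₃` is a leaf at `a₁`** (`o, a₂ ≠ a₃`): mine-a's Theorem A in the `S`-level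
vocabulary — the first kernel instance class of the covariance-monotone statement. -/
theorem cd_of_leaf (hp : IsProbVec p) (hl : CaseOne.IsLeafAt ends a₁ a₃ e₀) (ho : o ≠ a₃)
    (h2 : a₂ ≠ a₃) : CD p ends o a₁ a₂ a₃ := by
  intro F hF
  rw [← covS_sub_const_left p ends a₁ a₂ F (phi p ends o a₁ a₂ a₃) (F ∅)]
  set G : Set V → R := fun W => F W - F ∅ with hGdef
  have hG : Monotone G := fun W W' h => by
    show F W - F ∅ ≤ F W' - F ∅
    linarith [hF h]
  have hG0 : ∀ W : Set V, 0 ≤ G W := fun W => by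
    show 0 ≤ F W - F ∅
    linarith [hF (Set.empty_subset W)]
  rw [covS_phi_eq_omega]
  -- the leaf edge is the case-1 indicator
  have he : 𝟙e = (openEdge e₀).indicator (1 : Config E → R) := by
    rw [CaseOne.connEvent_leaf_eq_openEdge hl]
  have hfu : ∀ (ω : Config E) (c : Bool), 𝟙f (Function.update ω e₀ c) = 𝟙f ω :=
    fun ω c => CaseOne.connEvent_indicator_update_of_leaf hl ω c h2 ho
  have hou : ∀ (ω : Config E) (c : Bool), 𝟙o₁ (Function.update ω e₀ c) = 𝟙o₁ ω :=
    fun ω c => CaseOne.connEvent_indicator_update_of_leaf hl ω c hl.ne ho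
  have hQu : ∀ (ω : Config E) (c : Bool), 𝟙Q (Function.update ω e₀ c) = 𝟙Q ω :=
    Q_indicator_update ends a₁ a₂ a₃ e₀ hl h2
  -- abbreviations
  set q := prob p Q with hq_def
  set X := expect p (fun ω => G (cluster ends (Function.update ω e₀ true) a₁) * 𝟙f ω * 𝟙Q ω) with hX
  set Y := expect p (fun ω => G (cluster ends (Function.update ω e₀ true) a₁) * 𝟙Q ω) with hY
  set Y0 := expect p (fun ω => G (cluster ends (Function.update ω e₀ false) a₁) * 𝟙Q ω) with hY0
  set Z := expect p (fun ω => 𝟙f ω * 𝟙Q ω) with hZ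
  set M := expect p (fun ω => 𝟙o₁ ω * 𝟙Q ω) with hM
  have hqE : q = expect p 𝟙Q := prob_eq_expect_indicator p Q
  -- the five expectation identities
  have hE1 : expect p (fun ω => G (cluster ends ω a₁) * 𝟙e ω * 𝟙f ω * 𝟙Q ω) = p e₀ * X := by
    rw [he, show (fun ω => G (cluster ends ω a₁) * (openEdge e₀).indicator (1 : Config E → R) ω *
        𝟙f ω * 𝟙Q ω) = fun ω => (G (cluster ends ω a₁) * 𝟙f ω * 𝟙Q ω) *
        (openEdge e₀).indicator 1 ω from by funext ω; ring,
      expect_mul_openEdge p e₀, hX]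
    congr 2; funext ω
    rw [hfu, hQu]
  have hE2 : expect p (fun ω => G (cluster ends ω a₁) * 𝟙e ω * 𝟙Q ω) = p e₀ * Y := by
    rw [he, show (fun ω => G (cluster ends ω a₁) * (openEdge e₀).indicator (1 : Config E → R) ω *
        𝟙Q ω) = fun ω => (G (cluster ends ω a₁) * 𝟙Q ω) * (openEdge e₀).indicator 1 ω from by
        funext ω; ring,
      expect_mul_openEdge p e₀, hY]
    congr 2; funext ω
    rw [hQu]
  have hE3 : expect p (fun ω => G (cluster ends ω a₁) * 𝟙Q ω) = p e₀ * Y + (1 - p e₀) * Y0 := by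
    rw [expect_split p e₀, hY, hY0]
    congr 2 <;> (congr 1; funext ω; rw [hQu])
  have hE4 : expect p (fun ω => 𝟙e ω * 𝟙f ω * 𝟙Q ω) = p e₀ * Z := by
    rw [he, show (fun ω => (openEdge e₀).indicator (1 : Config E → R) ω * 𝟙f ω * 𝟙Q ω) =
        fun ω => (𝟙f ω * 𝟙Q ω) * (openEdge e₀).indicator 1 ω from by funext ω; ring,
      expect_mul_openEdge p e₀, hZ]
    congr 2; funext ω
    rw [hfu, hQu]
  have hE5 : expect p (fun ω => 𝟙e ω * 𝟙Q ω) = p e₀ * q := by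
    rw [he, show (fun ω => (openEdge e₀).indicator (1 : Config E → R) ω * 𝟙Q ω) =
        fun ω => 𝟙Q ω * (openEdge e₀).indicator 1 ω from by funext ω; ring,
      expect_mul_openEdge p e₀, hqE]
    congr 2; funext ω
    rw [hQu]
  -- `D` and `D_o`
  have hD : D = (1 - p e₀) * q := by
    rw [PDEvent_eq_of_leaf ends a₁ a₂ a₃ e₀ hl h2, prob_inter_closedEdge, prob_eq_expect_indicator,
      expect_update_zero, hqE]
    congr 2; funext ω
    rw [hQu]
  have hDo : Dₒ = (1 - p e₀) * (M + Z) := by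
    unfold CovForm.Do
    rw [PDEvent_eq_of_leaf ends a₁ a₂ a₃ e₀ hl h2,
      show Q ∩ closedEdge e₀ ∩ connEvent ends a₁ o = (Q ∩ connEvent ends a₁ o) ∩ closedEdge e₀ from by
        ext ω; simp only [Set.mem_inter_iff]; tauto,
      show Q ∩ closedEdge e₀ ∩ connEvent ends a₂ o = (Q ∩ connEvent ends a₂ o) ∩ closedEdge e₀ from by
        ext ω; simp only [Set.mem_inter_iff]; tauto,
      prob_inter_closedEdge, prob_inter_closedEdge, prob_eq_expect_indicator, prob_eq_expect_indicator,
      expect_update_zero, expect_update_zero, hM, hZ]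
    have i1 : ∀ ω : Config E, (Q ∩ connEvent ends a₁ o).indicator (1 : Config E → R)
        (Function.update ω e₀ false) = 𝟙o₁ ω * 𝟙Q ω := by
      intro ω
      rw [← CaseOne.ind_mul, hou, hQu, mul_comm]
    have i2 : ∀ ω : Config E, (Q ∩ connEvent ends a₂ o).indicator (1 : Config E → R)
        (Function.update ω e₀ false) = 𝟙f ω * 𝟙Q ω := by
      intro ω
      rw [← CaseOne.ind_mul, hfu, hQu, mul_comm]
    simp only [i1, i2]
    ring
  -- signs
  have hq : 0 ≤ q := prob_nonneg hp _
  have hMn : 0 ≤ M := expect_nonneg hp fun ω => mul_nonneg (Set.indicator_apply_nonneg fun _ => zero_le_one)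
    (Set.indicator_apply_nonneg fun _ => zero_le_one)
  have hp0 : 0 ≤ p e₀ := hp.nonneg e₀
  have hp1 : p e₀ ≤ 1 := hp.le_one e₀
  -- BHK 1.4 (functional) under `p[e₀ ↦ 1]`: `q X ≤ Y Z`
  have hBHK : q * X ≤ Y * Z := by
    have hp' : IsProbVec (Function.update p e₀ 1) := hp.update e₀ zero_le_one le_rfl
    have h := CaseOne.bhk_cross_cluster_fun (Function.update p e₀ 1) hp' ends a₁ a₂ hG hG0
      (isUpperSet_mem_setOf o)
    rw [CovForm.compl_connEvent_eq_Q, ← connEvent_eq_clusterInEvent, prob_eq_expect_indicator,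
      prob_eq_expect_indicator, expect_update_one, expect_update_one, expect_update_one,
      expect_update_one] at h
    have r1 : (fun ω => G (cluster ends (Function.update ω e₀ true) a₁) *
        ({W : Set V | o ∈ W}).indicator (1 : Set V → R) (cluster ends (Function.update ω e₀ true) a₂) *
        𝟙Q (Function.update ω e₀ true)) =
        fun ω => G (cluster ends (Function.update ω e₀ true) a₁) * 𝟙f ω * 𝟙Q ω := by
      funext ω
      rw [CaseOne.ind_cluster_eq, hfu, hQu]
    have r2 : (fun ω => 𝟙Q (Function.update ω e₀ true)) = 𝟙Q := by
      funext ω; rw [hQu]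
    have r3 : (fun ω => G (cluster ends (Function.update ω e₀ true) a₁) *
        𝟙Q (Function.update ω e₀ true)) =
        fun ω => G (cluster ends (Function.update ω e₀ true) a₁) * 𝟙Q ω := by
      funext ω; rw [hQu]
    have r4 : (fun ω => (connEvent ends a₂ o ∩ Q).indicator (1 : Config E → R)
        (Function.update ω e₀ true)) = fun ω => 𝟙f ω * 𝟙Q ω := by
      funext ω
      rw [← CaseOne.ind_mul, hfu, hQu]
    rw [r1, r2, r3, r4] at h
    rw [hX, hY, hZ, hqE]
    linarith [h]
  -- monotonicity: `Y0 ≤ Y`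
  have hYY : Y0 ≤ Y := by
    refine expect_mono hp fun ω => ?_
    exact mul_le_mul_of_nonneg_right
      (hG (cluster_mono (update_false_le_update_true ω e₀) a₁))
      (Set.indicator_apply_nonneg fun _ => zero_le_one)
  -- the algebra
  rw [hE1, hE2, hE3, hE4, hE5, hD, hDo]
  have key : q * ((1 - p e₀) * q * (p e₀ * X) - (1 - p e₀) * (M + Z) * (p e₀ * Y)) -
      (p e₀ * Y + (1 - p e₀) * Y0) * ((1 - p e₀) * q * (p e₀ * Z) - (1 - p e₀) * (M + Z) * (p e₀ * q)) =
      p e₀ * (1 - p e₀) * q * ((q * X - Y * Z) - (1 - p e₀) * M * (Y - Y0)) := by ring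
  rw [key]
  apply mul_nonpos_of_nonneg_of_nonpos (mul_nonneg (mul_nonneg hp0 (sub_nonneg.2 hp1)) hq)
  have : 0 ≤ (1 - p e₀) * M * (Y - Y0) :=
    mul_nonneg (mul_nonneg (sub_nonneg.2 hp1) hMn) (sub_nonneg.2 hYY)
  linarith

end Leaf

end SLevel

end Summit.Ventures.PercRepro2
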